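import Mathlib
import Summits.KontsevichZagierPeriods.Zeta5Search.DenomLaw.OriginCoverKit
import Summits.KontsevichZagierPeriods.Zeta5Search.DenomLaw.Profile20Path
import HarnessLib

/-!
# ζ(5) search — two ORIGIN windows at frame depth `M = 6` for general sorted `b`: line data and the bound `5 − 2M = −7` — DENOM-LAW prover-d1 gen 18

HONEST FRAMING: systematic search; no irrationality claim unless certified.  Cell `pub-zeta5`, track «DENOM-LAW», seat `denom-prover-d1`
gen 18 (`HOME/denom-law/prover-d1/ATTEMPT-18.md` §2).  `p`-adic valuation bookkeeping for the explicit rationals `Cas_j(b)`; nothing about ζ(5); no model exponent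
moves; records in print UNMOVED.

The ORIGIN type-space law (`ResidueLaw.typeSpaceLawOrigin_holds`, `M ≥ 6` even) is consumed through `OriginWindows.bound_of_classes` = class structure
`OriginWindowClasses b p M D S P` + `LineData u c D S P` (finitely many rational identities of the type functionals).  The tree's line data so far live at `M = 8`
(`Ray4Windows.lineData8`, `T1Rays.lineData8c`, gen 17's `lineData8x`: the universal line `u8 = (33, −49)`, `c8 = −174`).  Gen 18's global census finds the FIRST
`M = 6` origin windows of the node `DenomLaw.PathAccountingFirstPeriod`: the cells `⌊d/p⌋ = 2` of two `N_p = 15` profiles of a general sorted `b` —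
* short blocks `(1,2),(1,3),(1,4),(2,3),(2,4),(3,4)`: deep conjugate pair `[1,−2,−6,1]` / `[1,−6,−2,1]` at `−6`, sub-deep pairs `[1,−1,−6,1]`, `[1,−2,−5,1]`,
  `[1,1,−6,−2,1]` (and reversals) at `−5`; ALL their doubled orbit points lie on the line **`9·V + 16·W = −70`** (`u = (9, −16)`, `c = −70`; `lineData6d`);
* short blocks `(1,2),…,(1,6),(2,3)`: deep pair `[1,−3,−5,1]` / `[1,−5,−3,1]` and the palindrome `[1,−4,−4,1]` at `−6`, sub-deep pairs `[1,−2,−5,1]`, `[1,−3,−4,1]` and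
  the odd-centre `[1,−4,−4,1]` at `−5`; all on the line **`−8·V − 11·W = −28`** (`u = (−8, 11)`, `c = −28`; `lineData6b`).
Each identity is `decide +kernel` on the computable mirrors (`TypeEval.typeRho_eq_typeRhoC`), exactly as `Ray4Windows.d8_*` / `s8_*`; no definition (lists and
constants literal).  Wrappers `origin_O6d` / `origin_O6b`: the class structure + `4p ≤ 2d(b) + 1` ⇒ `−7 ≤ v_p(Cas_j(b))`, any `b`, any `j` (gen 17's
`DenomLaw.originBound_of_classes`).  Valuations of explicit rationals; every model exponent these feed is `< 1`.
-/

open Finset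

namespace Summit.KontsevichZagierPeriods.Zeta5Search.DenomLaw

open Summit.KontsevichZagierPeriods.Zeta5Search.ClusterValuation
open Summit.KontsevichZagierPeriods.Zeta5Search.CasoratianValuation (InPolytope shift casoratian)
open Summit.KontsevichZagierPeriods.Zeta5Search.WedgeDictionary (dOf)
open Summit.KontsevichZagierPeriods.Zeta5Search.SecondOrder (typeW2 typeV2 typeTauW typeTauV)
open Summit.KontsevichZagierPeriods.Zeta5Search.OriginWindows (OriginWindowClasses LineData lineVal deepPt dirVec)
open Summit.KontsevichZagierPeriods.Zeta5Search.ZeroWindows (pairPoint deepPoint)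
open Summit.KontsevichZagierPeriods.Zeta5Search.TypeEval (typeRho_eq_typeRhoC)

variable {p : ℕ}

/-! ## §1 The window `(6; [1,−2,−6,1])`: line `u = (9, −16)`, `c = −70` -/

set_option maxHeartbeats 8000000 in
/-- Line datum (`M = 6`, window d): deep type `[1, -2, -6, 1]`, its exact orbit vector is `∥ (9, −16)`. -/
theorem d6d_dir_1 : lineVal (9, -16) (dirVec [1, -2, -6, 1]) = 0 := by
  unfold lineVal dirVec LevelClass.typeW LevelClass.typeV; simp only [typeRho_eq_typeRhoC]; decide +kernel

set_option maxHeartbeats 8000000 in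
/-- Line datum (`M = 6`, window d): deep type `[1, -2, -6, 1]`, its doubled orbit point has `Φ_u = −70`. -/
theorem d6d_pt_1 : lineVal (9, -16) (deepPt [1, -2, -6, 1]) = (-70 : ℚ) := by
  unfold lineVal deepPt typeTauW typeTauV typeW2 typeV2 LevelClass.typeW LevelClass.typeV; simp only [typeRho_eq_typeRhoC]; decide +kernel

set_option maxHeartbeats 8000000 in
/-- Line datum (`M = 6`, window d): deep type `[1, -6, -2, 1]`, its exact orbit vector is `∥ (9, −16)`. -/
theorem d6d_dir_2 : lineVal (9, -16) (dirVec [1, -6, -2, 1]) = 0 := by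
  unfold lineVal dirVec LevelClass.typeW LevelClass.typeV; simp only [typeRho_eq_typeRhoC]; decide +kernel

set_option maxHeartbeats 8000000 in
/-- Line datum (`M = 6`, window d): deep type `[1, -6, -2, 1]`, its doubled orbit point has `Φ_u = −70`. -/
theorem d6d_pt_2 : lineVal (9, -16) (deepPt [1, -6, -2, 1]) = (-70 : ℚ) := by
  unfold lineVal deepPt typeTauW typeTauV typeW2 typeV2 LevelClass.typeW LevelClass.typeV; simp only [typeRho_eq_typeRhoC]; decide +kernel

set_option maxHeartbeats 8000000 in
/-- Line datum (`M = 6`, window d): sub-deep type `[1, -1, -6, 1]`, its pair point has `Φ_u = −70`. -/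
theorem s6d_pt_1 : lineVal (9, -16) (pairPoint [1, -1, -6, 1]) = (-70 : ℚ) := by
  unfold lineVal ZeroWindows.pairPoint LevelClass.typeW LevelClass.typeV; simp only [typeRho_eq_typeRhoC]; decide +kernel

set_option maxHeartbeats 8000000 in
/-- Line datum (`M = 6`, window d): sub-deep type `[1, -6, -1, 1]`, its pair point has `Φ_u = −70`. -/
theorem s6d_pt_2 : lineVal (9, -16) (pairPoint [1, -6, -1, 1]) = (-70 : ℚ) := by
  unfold lineVal ZeroWindows.pairPoint LevelClass.typeW LevelClass.typeV; simp only [typeRho_eq_typeRhoC]; decide +kernel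

set_option maxHeartbeats 8000000 in
/-- Line datum (`M = 6`, window d): sub-deep type `[1, -2, -5, 1]`, its pair point has `Φ_u = −70`. -/
theorem s6d_pt_3 : lineVal (9, -16) (pairPoint [1, -2, -5, 1]) = (-70 : ℚ) := by
  unfold lineVal ZeroWindows.pairPoint LevelClass.typeW LevelClass.typeV; simp only [typeRho_eq_typeRhoC]; decide +kernel

set_option maxHeartbeats 8000000 in
/-- Line datum (`M = 6`, window d): sub-deep type `[1, -5, -2, 1]`, its pair point has `Φ_u = −70`. -/
theorem s6d_pt_4 : lineVal (9, -16) (pairPoint [1, -5, -2, 1]) = (-70 : ℚ) := by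
  unfold lineVal ZeroWindows.pairPoint LevelClass.typeW LevelClass.typeV; simp only [typeRho_eq_typeRhoC]; decide +kernel

set_option maxHeartbeats 8000000 in
/-- Line datum (`M = 6`, window d): sub-deep type `[1, 1, -6, -2, 1]`, its pair point has `Φ_u = −70`. -/
theorem s6d_pt_5 : lineVal (9, -16) (pairPoint [1, 1, -6, -2, 1]) = (-70 : ℚ) := by
  unfold lineVal ZeroWindows.pairPoint LevelClass.typeW LevelClass.typeV; simp only [typeRho_eq_typeRhoC]; decide +kernel

set_option maxHeartbeats 8000000 in
/-- Line datum (`M = 6`, window d): sub-deep type `[1, -2, -6, 1, 1]`, its pair point has `Φ_u = −70`. -/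
theorem s6d_pt_6 : lineVal (9, -16) (pairPoint [1, -2, -6, 1, 1]) = (-70 : ℚ) := by
  unfold lineVal ZeroWindows.pairPoint LevelClass.typeW LevelClass.typeV; simp only [typeRho_eq_typeRhoC]; decide +kernel

/-- **The line data of the `M = 6` window d HOLD** (`D = [[1, -2, -6, 1], [1, -6, -2, 1]]`, `S` = the three sub-deep pairs in both orientations, no centre type). -/
theorem lineData6d : LineData (9, -16) (-70 : ℚ) [[1, -2, -6, 1], [1, -6, -2, 1]]
    [[1, -1, -6, 1], [1, -6, -1, 1], [1, -2, -5, 1], [1, -5, -2, 1], [1, 1, -6, -2, 1], [1, -2, -6, 1, 1]] [] := by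
  refine ⟨?_, ?_, ?_⟩
  · intro T hT
    simp only [List.mem_cons, List.not_mem_nil, or_false] at hT
    rcases hT with rfl | rfl
    · exact ⟨d6d_dir_1, d6d_pt_1⟩
    · exact ⟨d6d_dir_2, d6d_pt_2⟩
  · intro s hs
    simp only [List.mem_cons, List.not_mem_nil, or_false] at hs
    rcases hs with rfl | rfl | rfl | rfl | rfl | rfl
    · exact s6d_pt_1
    · exact s6d_pt_2
    · exact s6d_pt_3
    · exact s6d_pt_4
    · exact s6d_pt_5
    · exact s6d_pt_6
  · intro T hT
    simp at hT

/-- `(9, −16)` is primitive, so never `≡ 0 (mod p)`. -/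
theorem u6d_ne (hq : p.Prime) : ¬ ((p : ℤ) ∣ ((9, -16) : ℤ × ℤ).1 ∧ (p : ℤ) ∣ ((9, -16) : ℤ × ℤ).2) := by
  rintro ⟨h1, h2⟩
  have h := Int.dvd_gcd h1 h2
  rw [show Int.gcd ((9, -16) : ℤ × ℤ).1 ((9, -16) : ℤ × ℤ).2 = 1 by decide +kernel] at h
  exact hq.one_lt.ne' (Nat.dvd_one.1 (by exact_mod_cast h))

/-- **The `M = 6` ORIGIN instance, window d**: the class structure at `(6; D, S, [])` and `4p ≤ 2d(b) + 1` give `−7 ≤ v_p(Cas_j(b))` for every admissible `j`. -/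
theorem origin_O6d {b : ℕ → ℤ} {j : ℕ} (hb : InPolytope b) (hb' : InPolytope (shift b j)) (hj1 : 1 ≤ j) (hj7 : j ≤ 7)
    (hpr : p.Prime) (hp5 : 5 ≤ p) (hpb : (p : ℤ) ≤ b 0) (hwin : (b 0 + 2 : ℤ) < (p : ℤ) ^ 2)
    (hC : OriginWindowClasses b p 6 [[1, -2, -6, 1], [1, -6, -2, 1]]
      [[1, -1, -6, 1], [1, -6, -1, 1], [1, -2, -5, 1], [1, -5, -2, 1], [1, 1, -6, -2, 1], [1, -2, -6, 1, 1]] [])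
    (hdeg : (p : ℤ) * 4 ≤ 2 * dOf b + 1) (hcas : casoratian b j ≠ 0) : (-7 : ℤ) ≤ padicValRat p (casoratian b j) := by
  have h := originBound_of_classes hb hb' hj1 hj7 hpr hp5 hpb hwin (M := 6) le_rfl (by decide) (u6d_ne hpr) lineData6d hC (by simpa using hdeg) hcas
  simpa using h

/-! ## §2 The window `(6; [1,−3,−5,1], [1,−4,−4,1])`: line `u = (−8, 11)`, `c = −28` -/

set_option maxHeartbeats 8000000 in
/-- Line datum (`M = 6`, window b): deep type `[1, -3, -5, 1]`, its exact orbit vector is `∥ (−8, 11)`. -/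
theorem d6b_dir_1 : lineVal (-8, 11) (dirVec [1, -3, -5, 1]) = 0 := by
  unfold lineVal dirVec LevelClass.typeW LevelClass.typeV; simp only [typeRho_eq_typeRhoC]; decide +kernel

set_option maxHeartbeats 8000000 in
/-- Line datum (`M = 6`, window b): deep type `[1, -3, -5, 1]`, its doubled orbit point has `Φ_u = −28`. -/
theorem d6b_pt_1 : lineVal (-8, 11) (deepPt [1, -3, -5, 1]) = (-28 : ℚ) := by
  unfold lineVal deepPt typeTauW typeTauV typeW2 typeV2 LevelClass.typeW LevelClass.typeV; simp only [typeRho_eq_typeRhoC]; decide +kernel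

set_option maxHeartbeats 8000000 in
/-- Line datum (`M = 6`, window b): deep type `[1, -5, -3, 1]`, its exact orbit vector is `∥ (−8, 11)`. -/
theorem d6b_dir_2 : lineVal (-8, 11) (dirVec [1, -5, -3, 1]) = 0 := by
  unfold lineVal dirVec LevelClass.typeW LevelClass.typeV; simp only [typeRho_eq_typeRhoC]; decide +kernel

set_option maxHeartbeats 8000000 in
/-- Line datum (`M = 6`, window b): deep type `[1, -5, -3, 1]`, its doubled orbit point has `Φ_u = −28`. -/
theorem d6b_pt_2 : lineVal (-8, 11) (deepPt [1, -5, -3, 1]) = (-28 : ℚ) := by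
  unfold lineVal deepPt typeTauW typeTauV typeW2 typeV2 LevelClass.typeW LevelClass.typeV; simp only [typeRho_eq_typeRhoC]; decide +kernel

set_option maxHeartbeats 8000000 in
/-- Line datum (`M = 6`, window b): deep type `[1, -4, -4, 1]`, its exact orbit vector is `∥ (−8, 11)`. -/
theorem d6b_dir_3 : lineVal (-8, 11) (dirVec [1, -4, -4, 1]) = 0 := by
  unfold lineVal dirVec LevelClass.typeW LevelClass.typeV; simp only [typeRho_eq_typeRhoC]; decide +kernel

set_option maxHeartbeats 8000000 in
/-- Line datum (`M = 6`, window b): deep type `[1, -4, -4, 1]`, its doubled orbit point has `Φ_u = −28`. -/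
theorem d6b_pt_3 : lineVal (-8, 11) (deepPt [1, -4, -4, 1]) = (-28 : ℚ) := by
  unfold lineVal deepPt typeTauW typeTauV typeW2 typeV2 LevelClass.typeW LevelClass.typeV; simp only [typeRho_eq_typeRhoC]; decide +kernel

set_option maxHeartbeats 8000000 in
/-- Line datum (`M = 6`, window b): sub-deep type `[1, -2, -5, 1]`, its pair point has `Φ_u = −28`. -/
theorem s6b_pt_1 : lineVal (-8, 11) (pairPoint [1, -2, -5, 1]) = (-28 : ℚ) := by
  unfold lineVal ZeroWindows.pairPoint LevelClass.typeW LevelClass.typeV; simp only [typeRho_eq_typeRhoC]; decide +kernel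

set_option maxHeartbeats 8000000 in
/-- Line datum (`M = 6`, window b): sub-deep type `[1, -5, -2, 1]`, its pair point has `Φ_u = −28`. -/
theorem s6b_pt_2 : lineVal (-8, 11) (pairPoint [1, -5, -2, 1]) = (-28 : ℚ) := by
  unfold lineVal ZeroWindows.pairPoint LevelClass.typeW LevelClass.typeV; simp only [typeRho_eq_typeRhoC]; decide +kernel

set_option maxHeartbeats 8000000 in
/-- Line datum (`M = 6`, window b): sub-deep type `[1, -3, -4, 1]`, its pair point has `Φ_u = −28`. -/
theorem s6b_pt_3 : lineVal (-8, 11) (pairPoint [1, -3, -4, 1]) = (-28 : ℚ) := by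
  unfold lineVal ZeroWindows.pairPoint LevelClass.typeW LevelClass.typeV; simp only [typeRho_eq_typeRhoC]; decide +kernel

set_option maxHeartbeats 8000000 in
/-- Line datum (`M = 6`, window b): sub-deep type `[1, -4, -3, 1]`, its pair point has `Φ_u = −28`. -/
theorem s6b_pt_4 : lineVal (-8, 11) (pairPoint [1, -4, -3, 1]) = (-28 : ℚ) := by
  unfold lineVal ZeroWindows.pairPoint LevelClass.typeW LevelClass.typeV; simp only [typeRho_eq_typeRhoC]; decide +kernel

set_option maxHeartbeats 8000000 in
/-- Line datum (`M = 6`, window b): the odd-centre sub-deep class of type `[1,−4,−4,1]`, its doubled orbit point `2τ(T)` has `Φ_u = −28`. -/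
theorem p6b_pt : lineVal (-8, 11) (deepPoint [1, -4, -4, 1]) = (-28 : ℚ) := by
  unfold lineVal ZeroWindows.deepPoint typeTauW typeTauV typeW2 typeV2 LevelClass.typeW LevelClass.typeV; simp only [typeRho_eq_typeRhoC]; decide +kernel

/-- **The line data of the `M = 6` window b HOLD** (`D = [[1, -3, -5, 1], [1, -5, -3, 1], [1, -4, -4, 1]]`, `S` = two sub-deep pairs in both orientations, `P = [[1, -4, -4, 1]]`). -/
theorem lineData6b : LineData (-8, 11) (-28 : ℚ) [[1, -3, -5, 1], [1, -5, -3, 1], [1, -4, -4, 1]]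
    [[1, -2, -5, 1], [1, -5, -2, 1], [1, -3, -4, 1], [1, -4, -3, 1]] [[1, -4, -4, 1]] := by
  refine ⟨?_, ?_, ?_⟩
  · intro T hT
    simp only [List.mem_cons, List.not_mem_nil, or_false] at hT
    rcases hT with rfl | rfl | rfl
    · exact ⟨d6b_dir_1, d6b_pt_1⟩
    · exact ⟨d6b_dir_2, d6b_pt_2⟩
    · exact ⟨d6b_dir_3, d6b_pt_3⟩
  · intro s hs
    simp only [List.mem_cons, List.not_mem_nil, or_false] at hs
    rcases hs with rfl | rfl | rfl | rfl
    · exact s6b_pt_1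
    · exact s6b_pt_2
    · exact s6b_pt_3
    · exact s6b_pt_4
  · intro T hT
    simp only [List.mem_cons, List.not_mem_nil, or_false] at hT
    rcases hT with rfl
    exact ⟨by decide, p6b_pt⟩

/-- `(−8, 11)` is primitive, so never `≡ 0 (mod p)`. -/
theorem u6b_ne (hq : p.Prime) : ¬ ((p : ℤ) ∣ ((-8, 11) : ℤ × ℤ).1 ∧ (p : ℤ) ∣ ((-8, 11) : ℤ × ℤ).2) := by
  rintro ⟨h1, h2⟩
  have h := Int.dvd_gcd h1 h2
  rw [show Int.gcd ((-8, 11) : ℤ × ℤ).1 ((-8, 11) : ℤ × ℤ).2 = 1 by decide +kernel] at h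
  exact hq.one_lt.ne' (Nat.dvd_one.1 (by exact_mod_cast h))

/-- **The `M = 6` ORIGIN instance, window b**: the class structure at `(6; D, S, P)` and `4p ≤ 2d(b) + 1` give `−7 ≤ v_p(Cas_j(b))` for every admissible `j`. -/
theorem origin_O6b {b : ℕ → ℤ} {j : ℕ} (hb : InPolytope b) (hb' : InPolytope (shift b j)) (hj1 : 1 ≤ j) (hj7 : j ≤ 7)
    (hpr : p.Prime) (hp5 : 5 ≤ p) (hpb : (p : ℤ) ≤ b 0) (hwin : (b 0 + 2 : ℤ) < (p : ℤ) ^ 2)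
    (hC : OriginWindowClasses b p 6 [[1, -3, -5, 1], [1, -5, -3, 1], [1, -4, -4, 1]]
      [[1, -2, -5, 1], [1, -5, -2, 1], [1, -3, -4, 1], [1, -4, -3, 1]] [[1, -4, -4, 1]])
    (hdeg : (p : ℤ) * 4 ≤ 2 * dOf b + 1) (hcas : casoratian b j ≠ 0) : (-7 : ℤ) ≤ padicValRat p (casoratian b j) := by
  have h := originBound_of_classes hb hb' hj1 hj7 hpr hp5 hpb hwin (M := 6) le_rfl (by decide) (u6b_ne hpr) lineData6b hC (by simpa using hdeg) hcas
  simpa using h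

end Summit.KontsevichZagierPeriods.Zeta5Search.DenomLaw
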